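import Summits.Ventures.LatticeQCDFlow.Scaling.SimulatedTemperingModeTorpid
import Summits.Ventures.LatticeQCDFlow.Scaling.EquilibriumHittingFloor

/-!
HONEST FRAMING: exact (Metropolis-corrected) sampling algorithms for lattice gauge theory; figures
of merit are autocorrelation/cost numbers at stated couplings and volumes; no continuum-physics
claim.

# SimulatedTemperingSectorHitting — FROM EQUILIBRIUM THE TEMPERING SAMPLER FIRST HOLDS A CONFIGURATION OF SECTOR `A`
# (AT ANY LEVEL) NO SOONER THAN THE LADDER-AVERAGED EXIT FLOW ALLOWS:
# `E_π(H^T ∧ N) ≥ N·(1 − m_A/(K+1)) − ½N(N−1)·((1−t)/(K+1))·Σ_k Q_k(A,Aᶜ)` FOR EVERY HORIZON `N` (lean-2 GEN-17, ours)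

Venture-side (OURS).  Cell `lqcd-flow` (pub-lqcd), unit `pub-lqcd-lean-2-g17`, 2026-08-25.  Docking of the generic
`Scaling/EquilibriumHittingFloor` (`E_π(H^A ∧ N) ≥ N·π(Aᶜ) − ½N(N−1)·Q(A,Aᶜ)`, stationarity only) to the exact
cut-flow identity of `Scaling/SimulatedTemperingModeTorpid` (`Q_P(T,Tᶜ) = ((1−t)/(K+1))·Σ_k Q_k(A,Aᶜ)` for
`T = univ ×ˢ A`, `π(T) = m_A/(K+1)`, `m_A = Σ_k μ_k(A)`), in the setting of chapter X (finite configuration space,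
exact weights, `P = stFinSampler t μ M`, `0 ≤ t ≤ 1`).

## What is proved

* `stFin_mass_product_compl` — `π(Tᶜ) = ((K+1) − m_A)/(K+1)`.
* **`stFin_sectorHitting_ge`** — for every set `A` of configurations and every horizon `N`,
  `Σ_p π(p)·E_p(H^T ∧ N) ≥ N·((K+1) − m_A)/(K+1) − ½N(N−1)·((1−t)/(K+1))·Σ_k Q_k(A,Aᶜ)`;
  **`stFin_sectorHitting_ge_half`** — while `(N−1)(1−t)·Σ_k Q_k(A,Aᶜ) ≤ (K+1) − m_A`:
  `Σ_p π(p)·E_p(H^T ∧ N) ≥ ½N·((K+1) − m_A)/(K+1)`;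
  `stFin_sectorHitting_meanHittingTime_ge` — the same floor for the untruncated `ℝ≥0∞`-valued mean hitting times.

Reading (no numerics implied): if every level's update leaves sector `A`'s complement at stationary rate at most
`ε` (`Q_k(A,Aᶜ) ≤ ε`), a tempering run started in equilibrium needs, on average, order
`min{N, ((K+1) − m_A)/((1−t)(K+1)ε)}` steps before ANY level holds a configuration of sector `A` — tempering does not
manufacture the first tunnelling event either.  NOT CLAIMED: tail bounds; replica exchange (the swap move can carry a
sector-`A` configuration between levels but cannot create one — the analogous statement needs the set
`{some replica in A}`, not typed); anything measured.  Literature grade (cell rule): ELEMENTARY, NEW TYPING; nothing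
cited as a fact; no new bib keys.
-/

noncomputable section

open Finset
open Literature.Probability.MarkovChains

namespace Summit.Ventures.LatticeQCDFlow.Scaling

variable {S : Type*} [Fintype S] [DecidableEq S] {K : ℕ} {μ : Fin (K + 1) → S → ℝ}
  {M : Fin (K + 1) → Matrix S S ℝ} {t : ℝ}

omit [DecidableEq S] in
/-- **`π(Tᶜ) = ((K+1) − m_A)/(K+1)`** for `T = univ ×ˢ A`. [ours] -/
theorem stFin_mass_product_compl [DecidableEq S] (hμ1 : ∀ k, ∑ x, μ k x = 1) (A : Finset S) :
    ∑ p ∈ ((univ : Finset (Fin (K + 1))) ×ˢ A)ᶜ, stFinLaw μ p = ((K + 1) - ∑ k, ∑ x ∈ A, μ k x) / (K + 1) := by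
  have h := sum_add_sum_compl ((univ : Finset (Fin (K + 1))) ×ˢ A) (stFinLaw μ)
  rw [sum_stFinLaw hμ1, stFin_mass_product] at h
  have hK : (0 : ℝ) < K + 1 := by positivity
  field_simp at h
  rw [eq_div_iff hK.ne']
  linarith

variable (hμ : ∀ k x, 0 < μ k x) (hμ1 : ∀ k, ∑ x, μ k x = 1) (hM : ∀ k, IsRowStochastic (M k))
  (hMrev : ∀ k, DetailedBalance (μ k) (M k)) (ht0 : 0 ≤ t) (ht1 : t ≤ 1)
include hμ hμ1 hM hMrev ht0 ht1

/-- **FROM EQUILIBRIUM THE SAMPLER FIRST HOLDS A CONFIGURATION OF SECTOR `A` LATE:** for every horizon `N`,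
`Σ_p π(p)E_p(H^T ∧ N) ≥ N·((K+1) − m_A)/(K+1) − ½N(N−1)·((1−t)/(K+1))·Σ_k Q_k(A,Aᶜ)`, `T = univ ×ˢ A`. [ours] -/
theorem stFin_sectorHitting_ge (A : Finset S) (N : ℕ) :
    N * (((K + 1) - ∑ k, ∑ x ∈ A, μ k x) / (K + 1))
        - (N * (N - 1) / 2) * ((1 - t) / (K + 1) * ∑ k, edgeMeasure (μ k) (M k) A Aᶜ)
      ≤ ∑ p, stFinLaw μ p
          * meanHitWithin (stFinSampler t μ M) (↑((univ : Finset (Fin (K + 1))) ×ˢ A) : Set (Fin (K + 1) × S)) N p := by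
  have hP := stFinSampler_isRowStochastic (M := M) hμ hM ht0 ht1
  have hst : IsStationary (stFinLaw μ) (stFinSampler t μ M) :=
    (stFinSampler_detailedBalance (t := t) (M := M) hμ hMrev).isStationary hP.2
  have h := stationaryMean_meanHitWithin_ge hP hst (fun p => (stFinLaw_pos hμ p).le)
    ((univ : Finset (Fin (K + 1))) ×ˢ A) N
  rwa [stFin_mass_product_compl hμ1, stFin_edgeMeasure_product] at h

/-- **While `(N−1)(1−t)·Σ_k Q_k(A,Aᶜ) ≤ (K+1) − m_A`, the equilibrium-averaged truncated hitting time of sector `A`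
is at least `½N·((K+1) − m_A)/(K+1)`.** [ours] -/
theorem stFin_sectorHitting_ge_half (A : Finset S) (N : ℕ)
    (hN : ((N : ℝ) - 1) * ((1 - t) * ∑ k, edgeMeasure (μ k) (M k) A Aᶜ) ≤ (K + 1) - ∑ k, ∑ x ∈ A, μ k x) :
    (N : ℝ) * (((K + 1) - ∑ k, ∑ x ∈ A, μ k x) / (K + 1)) / 2
      ≤ ∑ p, stFinLaw μ p
          * meanHitWithin (stFinSampler t μ M) (↑((univ : Finset (Fin (K + 1))) ×ˢ A) : Set (Fin (K + 1) × S)) N p := by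
  have hP := stFinSampler_isRowStochastic (M := M) hμ hM ht0 ht1
  have hst : IsStationary (stFinLaw μ) (stFinSampler t μ M) :=
    (stFinSampler_detailedBalance (t := t) (M := M) hμ hMrev).isStationary hP.2
  have hK : (0 : ℝ) < K + 1 := by positivity
  have hN' : ((N : ℝ) - 1) * edgeMeasure (stFinLaw μ) (stFinSampler t μ M) ((univ : Finset (Fin (K + 1))) ×ˢ A)
      (((univ : Finset (Fin (K + 1))) ×ˢ A)ᶜ) ≤ ∑ p ∈ ((univ : Finset (Fin (K + 1))) ×ˢ A)ᶜ, stFinLaw μ p := by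
    rw [stFin_edgeMeasure_product, stFin_mass_product_compl hμ1, le_div_iff₀ hK]
    calc ((N : ℝ) - 1) * ((1 - t) / (K + 1) * ∑ k, edgeMeasure (μ k) (M k) A Aᶜ) * (K + 1)
        = ((N : ℝ) - 1) * ((1 - t) * ∑ k, edgeMeasure (μ k) (M k) A Aᶜ) := by field_simp
      _ ≤ (K + 1) - ∑ k, ∑ x ∈ A, μ k x := hN
  have h := stationaryMean_meanHitWithin_ge_half hP hst (fun p => (stFinLaw_pos hμ p).le)
    ((univ : Finset (Fin (K + 1))) ×ˢ A) N hN'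
  rwa [stFin_mass_product_compl hμ1] at h

/-- **The same floor for the untruncated mean hitting times** (`ℝ≥0∞`-valued). [ours] -/
theorem stFin_sectorHitting_meanHittingTime_ge (A : Finset S) (N : ℕ) :
    ENNReal.ofReal (N * (((K + 1) - ∑ k, ∑ x ∈ A, μ k x) / (K + 1))
        - (N * (N - 1) / 2) * ((1 - t) / (K + 1) * ∑ k, edgeMeasure (μ k) (M k) A Aᶜ))
      ≤ ∑ p, ENNReal.ofReal (stFinLaw μ p)
          * meanHittingTime (stFinSampler t μ M) (↑((univ : Finset (Fin (K + 1))) ×ˢ A) : Set (Fin (K + 1) × S)) p := by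
  have hP := stFinSampler_isRowStochastic (M := M) hμ hM ht0 ht1
  have hst : IsStationary (stFinLaw μ) (stFinSampler t μ M) :=
    (stFinSampler_detailedBalance (t := t) (M := M) hμ hMrev).isStationary hP.2
  have h := meanHittingTime_stationary_ge hP hst (fun p => (stFinLaw_pos hμ p).le)
    ((univ : Finset (Fin (K + 1))) ×ˢ A) N
  rwa [stFin_mass_product_compl hμ1, stFin_edgeMeasure_product] at h

end Summit.Ventures.LatticeQCDFlow.Scaling

end
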